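import Literature.Analysis.UnboundedOperators.LinearizedBoltzmannOperator
import HarnessLib

/-!
# The collision frequency of the linearised hard-sphere operator: positive lower bound, continuity

Sibling proof file of `LinearizedBoltzmannOperator.lean`. For the collision frequency
`ν(v) = ∫∫ ((v - v_*)·ω)₊ dω M(v_*) dv_*` (`collisionFrequency`) of Grad's splitting `L = -ν + K`
the tree has the upper bound `ν(v) ≤ C_ν (1 + |v|)` (`collisionFrequency_le`). Here we prove the
lower half of CIP 1994 §7.2 (2.15), `0 < ν₀ ≤ ν(v)` for all `v` (`exists_pos_le_collisionFrequency`),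
together with the linear lower bound `ν(v) ≥ s₀ |v|` (`exists_pos_mul_norm_le_collisionFrequency`)
and the positivity and continuity of `ν` (`collisionFrequency_pos_and_continuous`).

Proof: the angular factor `s(V) = ∫ (V·ω)₊ dω` is continuous, positively homogeneous of degree one
and positive for `V ≠ 0` (the surface measure charges the open cap `{V·ω > 0}`), hence
`s(V) ≥ s₀ |V|` with `s₀ = min_{|e| = 1} s(e) > 0` (compactness of the unit sphere); then
`ν(v) = ∫ s(v - w) dM(w) ≥ s₀ ∫ |v - w| dM(w) ≥ s₀ max (|v|, m₁ - |v|) ≥ s₀ m₁ / 2`, using that the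
Maxwellian is centred (`∫ w dM = 0`, Jensen) and `m₁ = ∫ |w| dM > 0`.

No new definitions are introduced (the constants are existentially quantified).

## References

* C. Cercignani, R. Illner, M. Pulvirenti, *The Mathematical Theory of Dilute Gases*, Springer
  (1994), §7.2 (2.15), p. 197: `0 < ν₀ ≤ ν(|ξ|) ≤ ν₁ (1 + |ξ|²)^{1/2}`.
-/

open MeasureTheory Metric Real Set Filter Topology ProbabilityTheory Module
open scoped InnerProductSpace ENNReal

namespace Literature.Analysis.UnboundedOperators

noncomputable section

open Literature.MathematicalPhysics.KineticTheory (sphereMeasure hardSphereKernel)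
open Literature.Analysis.FluidPDE

variable {E : Type*} [NormedAddCommGroup E] [InnerProductSpace ℝ E] [FiniteDimensional ℝ E]
  [MeasurableSpace E] [BorelSpace E]

/-! ### The angular factor `s(V) = ∫ (V·ω)₊ dω` -/

omit [FiniteDimensional ℝ E] [MeasurableSpace E] [BorelSpace E] in
/-- The hard-sphere kernel only depends on the relative velocity: `B(v, w, ω) = B(v - w, 0, ω)`.
[folklore] -/
theorem hardSphereKernel_eq_sub_zero (v w : E) (ω : sphere (0 : E) 1) :
    hardSphereKernel (v, w) ω = hardSphereKernel (v - w, 0) ω := by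
  simp [hardSphereKernel]

omit [FiniteDimensional ℝ E] [MeasurableSpace E] [BorelSpace E] in
/-- Positive homogeneity of the hard-sphere kernel in the relative velocity. [folklore] -/
theorem hardSphereKernel_smul_zero {t : ℝ} (ht : 0 ≤ t) (V : E) (ω : sphere (0 : E) 1) :
    hardSphereKernel (t • V, 0) ω = t * hardSphereKernel (V, 0) ω := by
  simp only [hardSphereKernel, sub_zero, real_inner_smul_left]
  rw [mul_max_of_nonneg _ _ ht, mul_zero]

/-- Positive homogeneity of the angular factor: `s(t V) = t s(V)` for `t ≥ 0`. [folklore] -/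
theorem sphereIntegral_hardSphereKernel_smul {t : ℝ} (ht : 0 ≤ t) (V : E) :
    ∫ ω, hardSphereKernel (t • V, 0) ω ∂sphereMeasure =
      t * ∫ ω, hardSphereKernel (V, 0) ω ∂sphereMeasure := by
  rw [← integral_const_mul]
  exact integral_congr_ae (Eventually.of_forall fun ω => hardSphereKernel_smul_zero ht V ω)

/-- The angular factor is positive off the origin: `∫ (V·ω)₊ dω > 0` for `V ≠ 0` (the integrand is
positive on the open cap `{V·ω > 0} ∋ V/|V|`, which has positive surface measure). [folklore] -/
theorem sphereIntegral_hardSphereKernel_pos {V : E} (hV : V ≠ 0) :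
    0 < ∫ ω, hardSphereKernel (V, 0) ω ∂sphereMeasure := by
  haveI := isFiniteMeasure_sphereMeasure (E := E)
  haveI : (sphereMeasure : Measure (sphere (0 : E) 1)).IsOpenPosMeasure := by
    unfold sphereMeasure; infer_instance
  have hcont : Continuous fun ω : sphere (0 : E) 1 => hardSphereKernel (V, 0) ω := by
    unfold hardSphereKernel; fun_prop
  have hint : Integrable (fun ω : sphere (0 : E) 1 => hardSphereKernel (V, 0) ω) sphereMeasure :=
    (integrable_const ‖V‖).mono' hcont.aestronglyMeasurable (Eventually.of_forall fun ω => by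
      rw [Real.norm_eq_abs, abs_of_nonneg (le_max_right _ _)]
      simpa [hardSphereKernel] using (le_abs_self _).trans (abs_inner_sphere_le V ω))
  have h0 : (0 : sphere (0 : E) 1 → ℝ) ≤ fun ω => hardSphereKernel (V, 0) ω :=
    fun ω => le_max_right _ _
  rw [integral_pos_iff_support_of_nonneg h0 hint]
  have hopen : IsOpen (Function.support fun ω : sphere (0 : E) 1 => hardSphereKernel (V, 0) ω) :=
    isOpen_ne_fun hcont continuous_const
  refine hopen.measure_pos _ ⟨⟨‖V‖⁻¹ • V, ?_⟩, ?_⟩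
  · rw [mem_sphere_zero_iff_norm, norm_smul, norm_inv, norm_norm, inv_mul_cancel₀ (norm_ne_zero_iff.2 hV)]
  · change hardSphereKernel (V, 0) ⟨‖V‖⁻¹ • V, _⟩ ≠ 0
    simp only [hardSphereKernel, sub_zero, real_inner_smul_right, real_inner_self_eq_norm_sq]
    have h : 0 < ‖V‖⁻¹ * ‖V‖ ^ 2 := by positivity
    exact (lt_max_of_lt_left h).ne'

/-- **Linear lower bound on the angular factor**: `∫ ((v - w)·ω)₊ dω ≥ s₀ |v - w|` with `s₀ > 0`
(`s₀` = the minimum of the continuous positive function `e ↦ ∫ (e·ω)₊ dω` on the unit sphere).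
[folklore] -/
theorem exists_pos_mul_norm_le_sphereIntegral_hardSphereKernel (hE : 0 < finrank ℝ E) :
    ∃ s₀ : ℝ, 0 < s₀ ∧ ∀ v w : E,
      s₀ * ‖v - w‖ ≤ ∫ ω, hardSphereKernel (v, w) ω ∂sphereMeasure := by
  haveI : Nontrivial E := Module.nontrivial_of_finrank_pos hE
  obtain ⟨e, he⟩ : ∃ e : E, ‖e‖ = 1 := by
    obtain ⟨x, hx⟩ := exists_ne (0 : E)
    exact ⟨‖x‖⁻¹ • x, by rw [norm_smul, norm_inv, norm_norm, inv_mul_cancel₀ (norm_ne_zero_iff.2 hx)]⟩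
  have hcont : Continuous fun V : E => ∫ ω, hardSphereKernel (V, 0) ω ∂sphereMeasure :=
    continuous_sphereIntegral_hardSphereKernel.comp (Continuous.prodMk_left (0 : E))
  obtain ⟨e₀, he₀, hmin⟩ := (isCompact_sphere (0 : E) 1).exists_isMinOn
    ⟨e, mem_sphere_zero_iff_norm.2 he⟩ hcont.continuousOn
  have he₀1 : ‖e₀‖ = 1 := mem_sphere_zero_iff_norm.1 he₀
  have he₀0 : e₀ ≠ 0 := by
    intro h; rw [h, norm_zero] at he₀1; exact zero_ne_one he₀1
  refine ⟨∫ ω, hardSphereKernel (e₀, 0) ω ∂sphereMeasure, sphereIntegral_hardSphereKernel_pos he₀0,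
    fun v w => ?_⟩
  rw [integral_congr_ae (Eventually.of_forall fun ω => hardSphereKernel_eq_sub_zero v w ω)]
  set V : E := v - w with hV
  by_cases hV0 : V = 0
  · simp [hV0, hardSphereKernel]
  have hnorm : 0 < ‖V‖ := norm_pos_iff.2 hV0
  have hdecomp : V = ‖V‖ • (‖V‖⁻¹ • V) := by
    rw [smul_smul, mul_inv_cancel₀ hnorm.ne', one_smul]
  have hunit : ‖V‖⁻¹ • V ∈ sphere (0 : E) 1 := by
    rw [mem_sphere_zero_iff_norm, norm_smul, norm_inv, norm_norm, inv_mul_cancel₀ hnorm.ne']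
  rw [hdecomp, sphereIntegral_hardSphereKernel_smul hnorm.le, norm_smul, norm_norm,
    mem_sphere_zero_iff_norm.1 hunit, mul_one, mul_comm]
  exact mul_le_mul_of_nonneg_left (hmin hunit) hnorm.le

/-! ### The collision frequency -/

/-- The first absolute moment of the Maxwellian is positive: `∫ |w| dM(w) > 0`. [folklore] -/
theorem integral_norm_stdGaussian_pos (hE : 0 < finrank ℝ E) :
    0 < ∫ w, ‖w‖ ∂stdGaussian E := by
  haveI : Nontrivial E := Module.nontrivial_of_finrank_pos hE
  haveI := isOpenPosMeasure_stdGaussian (E := E)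
  have hint : Integrable (fun w : E => ‖w‖) (stdGaussian E) := by
    simpa using (IsGaussian.memLp_id (stdGaussian E) 1 ENNReal.one_ne_top).integrable le_rfl |>.norm
  rw [integral_pos_iff_support_of_nonneg (fun w => norm_nonneg _) hint]
  have hsupp : Function.support (fun w : E => ‖w‖) = {0}ᶜ := by
    ext w; simp
  rw [hsupp]
  obtain ⟨x, hx⟩ := exists_ne (0 : E)
  exact isOpen_compl_singleton.measure_pos _ ⟨x, hx⟩

/-- **Positive lower bound on the collision frequency with linear growth**: there is `s₀ > 0`
with `ν(v) ≥ s₀ |v|` and `ν(v) ≥ s₀ (m₁ - |v|)`, `m₁ = ∫ |w| dM` (the Maxwellian is centred, so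
`∫ |v - w| dM ≥ |∫ (v - w) dM| = |v|`). [folklore] -/
theorem exists_pos_mul_norm_le_collisionFrequency (hE : 0 < finrank ℝ E) :
    ∃ s₀ : ℝ, 0 < s₀ ∧ ∀ v : E, s₀ * ‖v‖ ≤ collisionFrequency v ∧
      s₀ * ((∫ w, ‖w‖ ∂stdGaussian E) - ‖v‖) ≤ collisionFrequency v := by
  obtain ⟨s₀, hs₀, hle⟩ := exists_pos_mul_norm_le_sphereIntegral_hardSphereKernel hE
  have hnorm : Integrable (fun w : E => ‖w‖) (stdGaussian E) := by
    simpa using (IsGaussian.memLp_id (stdGaussian E) 1 ENNReal.one_ne_top).integrable le_rfl |>.norm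
  have hid : Integrable (fun w : E => w) (stdGaussian E) :=
    (IsGaussian.memLp_id (stdGaussian E) 1 ENNReal.one_ne_top).integrable le_rfl
  refine ⟨s₀, hs₀, fun v => ?_⟩
  have hsub : Integrable (fun w : E => ‖v - w‖) (stdGaussian E) := ((integrable_const v).sub hid).norm
  have hmain : s₀ * ∫ w, ‖v - w‖ ∂stdGaussian E ≤ collisionFrequency v := by
    rw [← integral_const_mul]
    exact integral_mono (hsub.const_mul s₀) (integrable_sphereIntegral_hardSphereKernel v)
      fun w => hle v w
  constructor
  · refine le_trans (mul_le_mul_of_nonneg_left ?_ hs₀.le) hmain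
    calc ‖v‖ = ‖∫ w, (v - w) ∂stdGaussian E‖ := by
          rw [integral_sub (integrable_const v) hid, integral_const, integral_id_stdGaussian,
            probReal_univ, one_smul, sub_zero]
      _ ≤ ∫ w, ‖v - w‖ ∂stdGaussian E := norm_integral_le_integral_norm _
  · refine le_trans (mul_le_mul_of_nonneg_left ?_ hs₀.le) hmain
    calc (∫ w, ‖w‖ ∂stdGaussian E) - ‖v‖ = ∫ w, (‖w‖ - ‖v‖) ∂stdGaussian E := by
          rw [integral_sub hnorm (integrable_const _), integral_const, probReal_univ, one_smul]
      _ ≤ ∫ w, ‖v - w‖ ∂stdGaussian E :=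
          integral_mono (hnorm.sub (integrable_const _)) hsub fun w => by
            have := norm_sub_norm_le w v
            rw [norm_sub_rev] at this
            linarith [abs_sub_abs_le_abs_sub ‖w‖ ‖v‖]

/-- **The collision frequency is bounded below by a positive constant** (the lower half of
CIP 1994 §7.2 (2.15), `0 < ν₀ ≤ ν(|ξ|)`): `ν(v) ≥ ν₀ := s₀ m₁ / 2 > 0` for all `v`.
[cite: CIPDiluteGases1994, §7.2 (2.15)] -/
theorem exists_pos_le_collisionFrequency (hE : 0 < finrank ℝ E) :
    ∃ ν₀ : ℝ, 0 < ν₀ ∧ ∀ v : E, ν₀ ≤ collisionFrequency v := by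
  obtain ⟨s₀, hs₀, h⟩ := exists_pos_mul_norm_le_collisionFrequency hE
  have hm := integral_norm_stdGaussian_pos hE
  set m₁ : ℝ := ∫ w, ‖w‖ ∂stdGaussian E with hm₁
  refine ⟨s₀ * m₁ / 2, by positivity, fun v => ?_⟩
  obtain ⟨h1, h2⟩ := h v
  by_cases hv : m₁ / 2 ≤ ‖v‖
  · calc s₀ * m₁ / 2 = s₀ * (m₁ / 2) := by ring
      _ ≤ s₀ * ‖v‖ := mul_le_mul_of_nonneg_left hv hs₀.le
      _ ≤ collisionFrequency v := h1
  · push Not at hv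
    calc s₀ * m₁ / 2 ≤ s₀ * (m₁ - ‖v‖) := by nlinarith
      _ ≤ collisionFrequency v := h2

/-- **The collision frequency is everywhere positive and continuous** (positivity from
`exists_pos_le_collisionFrequency`; continuity by dominated convergence: `s(v - w)` is continuous
in `v` and bounded by `σ(S) (|v| + |w|)`, locally uniformly `M dw`-integrable). The two facts are
bundled in one statement. [folklore] -/
theorem collisionFrequency_pos_and_continuous (hE : 0 < finrank ℝ E) :
    (∀ v : E, 0 < collisionFrequency v) ∧ Continuous (collisionFrequency (E := E)) := by
  obtain ⟨ν₀, hν₀, hlow⟩ := exists_pos_le_collisionFrequency hE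
  refine ⟨fun v => hν₀.trans_le (hlow v), ?_⟩
  have hnorm : Integrable (fun w : E => ‖w‖) (stdGaussian E) := by
    simpa using (IsGaussian.memLp_id (stdGaussian E) 1 ENNReal.one_ne_top).integrable le_rfl |>.norm
  set S : ℝ := (sphereMeasure : Measure (sphere (0 : E) 1)).real univ with hS
  refine continuous_iff_continuousAt.2 fun v₀ => ?_
  refine continuousAt_of_dominated (bound := fun w => S * (‖v₀‖ + 1 + ‖w‖)) ?_ ?_ ?_ ?_
  · exact Eventually.of_forall fun v =>
      (continuous_sphereIntegral_hardSphereKernel.comp (Continuous.prodMk_right v)).aestronglyMeasurable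
  · have hball : ∀ᶠ v in 𝓝 v₀, ‖v - v₀‖ < 1 := by
      have := Metric.ball_mem_nhds v₀ one_pos
      filter_upwards [this] with v hv
      rwa [mem_ball, dist_eq_norm] at hv
    filter_upwards [hball] with v hv
    refine Eventually.of_forall fun w => ?_
    rw [Real.norm_of_nonneg (sphereIntegral_hardSphereKernel_nonneg _)]
    refine (sphereIntegral_hardSphereKernel_le v w).trans ?_
    rw [hS]
    refine mul_le_mul_of_nonneg_left ?_ measureReal_nonneg
    have : ‖v‖ ≤ ‖v₀‖ + 1 := by
      have := norm_le_insert' v v₀; linarith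
    linarith
  · exact ((integrable_const _).add hnorm).const_mul S
  · exact Eventually.of_forall fun w =>
      (continuous_sphereIntegral_hardSphereKernel.comp (Continuous.prodMk_left w)).continuousAt

end

end Literature.Analysis.UnboundedOperators
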